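import Summits.KontsevichZagierPeriods.KontsevichZagierPeriods.Theses.IsogenyCertificates
import Literature.NumberTheory.Transcendental.KZKernelConjectureForms
import Literature.NumberTheory.Transcendental.KZSubcalculusInvariants
import Literature.NumberTheory.Transcendental.KZRulesAssociator

/-!
# `XMapKernel` (stmt-KontsevichZagierPeriods-10663): negative side — strength, shape of any refutation, load-bearing moves

Negative-side support for the rank-0 crux `XMapKernel` of route `IsogenyCertificates` (cdisprove
unit `refuter-cdisprove-stmt-KontsevichZagierPeriods-10663-0`; running commentary in the crux work
file `Cruxes/XMapKernel/Disproof.lean`). The crux: every formal `ℤ`-combination of integral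
representations of value `0` lies in the subgroup of `KZ.FormalRep` generated by the four move sets of
the Kontsevich–Zagier calculus [Kontsevich–Zagier 2001, §1.2, rules 1)–3)] together with the *x-map
period relators* `[r] − [r′]` (`r = [{P>0}, a/√P]`, `r′ = [{P′>0}, b/√P′]` joined by an x-rational
isogeny datum, equal values). Nothing here refutes it. This file records, as importable theorems:

* §0 vocabulary (`xMapRel`, `moves`, `gens`), `crux_iff` (`Iff.rfl`), and SOUNDNESS of the enlarged
  calculus (`closure_gens_le_ker_eval`: every x-map relator evaluates to `0` by its value conjunct, the
  moves by `KZ.relations_le_ker_eval_holds`), so the crux says `closure gens = ker eval`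
  (`crux_iff_closure_eq_ker`);
* §1 STRENGTH: the summit implies the crux (`not_summit_of_not`, via the tree equivalence
  `kzKernelConjecture_iff_isRational` and monotonicity of `AddSubgroup.closure`), modulo the sibling
  crux `XMapPeriodTransfer` the crux IS the summit (`iff_summit_of_transfer`), and the route thesis
  `XMapPeriodTransfer ∧ XMapKernel` is an exact reformulation of the summit (`thesis_iff_summit`);
* §2 the SHAPE of any refutation (`not_iff`, `not_of_separating_invariant`,
  `exists_separating_invariant_of_not`): an additive invariant of `KZ.FormalRep` killing the four move
  sets and the x-map relators but not `ker eval`;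
* §3 LOAD-BEARING ingredients: `false_without_eval` (`[pt,1]` is an honest generator of value `1`),
  `false_without_newtonLeibniz` (the dimension-`0` evaluation `dimZeroEval` kills rules (1a), (1b), (2)
  and the x-map relators but not the unit slab `[pt,1]·[0,1] − [pt,1]`: ANY PROOF MUST USE RULE 3),
  `false_without_additivity` (`KZ.coeffSum`; witness `[∅]`: ANY PROOF MUST USE AN ADDITIVITY RULE);
  dropping the x-map relators gives `KZKernelConjecture` verbatim (`withoutXMapRel_iff`);
* §4 refuted strengthenings by monotonicity (`not_ker_le_closure_of_subset_withoutNL/withoutAdd`,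
  `not_ker_le_closure_xMapRel`, `closure_gens_ne_top`).

Positive directions are deliberately stated as `↔` or contrapositives: no theorem of this file has a
route decl as its literal conclusion.

Sources: M. Kontsevich, D. Zagier, *Periods* (2001), §§1.1–1.2 (rules and Conjecture 1);
A. Huber, S. Müller-Stach, *Periods and Nori Motives* (2017), §13.1–13.2 (kernel form, Rem. 13.1.8).
-/

noncomputable section

namespace Summit.KontsevichZagierPeriods.XMapKernel.Negative

open Literature.NumberTheory.Transcendental
open Summit.KontsevichZagierPeriods.KontsevichZagierPeriods.Theses.IsogenyCertificates
open Set MeasureTheory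

/-! ### §0 Vocabulary and soundness of the enlarged calculus -/

/-- The x-map period relators, literally the fifth generating set of the crux:
`[r] − [r′]` for `r = [{P>0}, a/√P]`, `r′ = [{P′>0}, b/√P′]` joined by an x-rational isogeny datum
`(f, g, c)` (`W = f′g − fg′ ≠ 0`, `c²·g·(f³+A′fg²+B′g³) = P·W²`) and with EQUAL VALUES.
[cite: KontsevichZagier2001, §1.2] -/
def xMapRel : Set KZ.FormalRep :=
  {d | ∃ (A B A' B' : ℤ) (f g : Polynomial ℚ) (c a b : ℚ) (r r' : KZ.IntegralRep 1),
    4 * A ^ 3 + 27 * B ^ 2 ≠ 0 ∧ 4 * A' ^ 3 + 27 * B' ^ 2 ≠ 0 ∧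
    Polynomial.derivative f * g - f * Polynomial.derivative g ≠ 0 ∧
    Polynomial.C (c ^ 2) * g * (f ^ 3 + Polynomial.C (A' : ℚ) * f * g ^ 2 + Polynomial.C (B' : ℚ) * g ^ 3) =
      (Polynomial.X ^ 3 + Polynomial.C (A : ℚ) * Polynomial.X + Polynomial.C (B : ℚ)) *
        (Polynomial.derivative f * g - f * Polynomial.derivative g) ^ 2 ∧
    0 < a ∧ 0 < b ∧
    r.domain = {x | 0 < x 0 ^ 3 + (A : ℝ) * x 0 + (B : ℝ)} ∧
    Set.EqOn r.integrand (fun x => (a : ℝ) / Real.sqrt (x 0 ^ 3 + (A : ℝ) * x 0 + (B : ℝ))) r.domain ∧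
    r'.domain = {x | 0 < x 0 ^ 3 + (A' : ℝ) * x 0 + (B' : ℝ)} ∧
    Set.EqOn r'.integrand (fun x => (b : ℝ) / Real.sqrt (x 0 ^ 3 + (A' : ℝ) * x 0 + (B' : ℝ))) r'.domain ∧
    r.value = r'.value ∧ d = KZ.of r - KZ.of r'}

/-- The four move sets of the KZ calculus, rules (1a), (1b), (2), (3); their closure is
`KZ.relations` by definition. [cite: KontsevichZagier2001, §1.2] -/
def moves : Set KZ.FormalRep :=
  KZ.domainAddRel ∪ KZ.integrandAddRel ∪ KZ.changeOfVariablesRel ∪ KZ.newtonLeibnizRel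

/-- The crux's generating set: the four moves and the x-map relators. [folklore] -/
def gens : Set KZ.FormalRep := moves ∪ xMapRel

/-- `KZ.relations = closure moves` (definitional). [cite: KontsevichZagier2001, §1.2] -/
theorem relations_eq_closure_moves : KZ.relations = AddSubgroup.closure moves := rfl

/-- The crux, unfolded: `∀ c, eval c = 0 → c ∈ closure gens` (definitional). [folklore] -/
theorem crux_iff :
    XMapKernel ↔ ∀ c : KZ.FormalRep, KZ.eval c = 0 → c ∈ AddSubgroup.closure gens := Iff.rfl

/-- The same with `AddSubgroup`s: `ker eval ≤ closure gens`. [folklore] -/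
theorem crux_iff_ker_le : XMapKernel ↔ KZ.eval.ker ≤ AddSubgroup.closure gens := by
  rw [crux_iff]
  constructor
  · intro h c hc
    exact h c (by simpa using hc)
  · intro h c hc
    exact h (by simpa using hc)

/-- Every x-map relator evaluates to `0` (its value-equality conjunct); no datum analysis is needed,
junk data could only ENLARGE the relator set inside `ker eval`. [folklore] -/
theorem xMapRel_subset_ker_eval : xMapRel ⊆ (KZ.eval.ker : Set KZ.FormalRep) := by
  rintro d ⟨A, B, A', B', f, g, c, a, b, r, r', -, -, -, -, -, -, -, -, -, -, hv, rfl⟩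
  simp [KZ.eval_of_sub_of, hv]

/-- `relations ≤ closure gens` (monotonicity of the closure). [folklore] -/
theorem relations_le_closure_gens : KZ.relations ≤ AddSubgroup.closure gens :=
  AddSubgroup.closure_mono subset_union_left

/-- **Soundness of the enlarged calculus**: `closure gens ≤ ker eval` (the moves are sound,
`KZ.relations_le_ker_eval_holds`; the relators have equal values). [cite: KontsevichZagier2001, §1.2] -/
theorem closure_gens_le_ker_eval : AddSubgroup.closure gens ≤ KZ.eval.ker := by
  rw [AddSubgroup.closure_le]
  rintro d (hd | hd)
  · exact KZ.relations_le_ker_eval_holds (AddSubgroup.subset_closure hd)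
  · exact xMapRel_subset_ker_eval hd

/-- The crux says exactly `closure gens = ker eval`; the inclusion `≤` is the theorem above.
[folklore] -/
theorem crux_iff_closure_eq_ker : XMapKernel ↔ AddSubgroup.closure gens = KZ.eval.ker := by
  rw [crux_iff_ker_le]
  exact ⟨fun h => le_antisymm closure_gens_le_ker_eval h, fun h => h.ge⟩

/-! ### §1 Strength: the crux is a corollary of the summit, and modulo transfer it IS the summit -/

/-- **Kernel conjecture ⇒ crux** (monotonicity of the closure in the generating set), stated
contrapositively. [cite: KontsevichZagier2001, §1.2 Conjecture 1] -/
theorem not_kzKernelConjecture_of_not (h : ¬ XMapKernel) : ¬ KZKernelConjecture := fun hK =>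
  h fun c hc => relations_le_closure_gens (hK c hc)

/-- The summit statement is the kernel conjecture (tree: `kzKernelConjecture_iff_isRational`).
[cite: KontsevichZagier2001, §1.2 Conjecture 1] -/
theorem summit_iff_kzKernelConjecture : _root_.KontsevichZagierPeriods ↔ KZKernelConjecture :=
  KontsevichZagierPeriods_iff.trans kzKernelConjecture_iff_isRational.symm

/-- **The summit implies the crux** (contrapositive form): a refutation of `XMapKernel` is literally a
refutation of the formalised period conjecture; no cheaper refutation exists.
[cite: KontsevichZagier2001, §1.2 Conjecture 1] -/
theorem not_summit_of_not (h : ¬ XMapKernel) : ¬ _root_.KontsevichZagierPeriods := fun hs =>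
  not_kzKernelConjecture_of_not h (summit_iff_kzKernelConjecture.1 hs)

/-- The sibling crux `XMapPeriodTransfer` says exactly that the x-map relators are relations.
[folklore] -/
theorem xMapRel_subset_relations_iff_transfer :
    xMapRel ⊆ (KZ.relations : Set KZ.FormalRep) ↔ XMapPeriodTransfer := by
  constructor
  · intro h A B A' B' hΔ hΔ' f g c hW hI a b ha hb r r' h1 h2 h3 h4 h5
    exact h ⟨A, B, A', B', f, g, c, a, b, r, r', hΔ, hΔ', hW, hI, ha, hb, h1, h2, h3, h4, h5, rfl⟩
  · rintro hT d ⟨A, B, A', B', f, g, c, a, b, r, r', hΔ, hΔ', hW, hI, ha, hb, h1, h2, h3, h4, h5, rfl⟩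
    exact hT A B A' B' hΔ hΔ' f g c hW hI a b ha hb r r' h1 h2 h3 h4 h5

/-- If the x-map relators are relations, `closure gens = relations`. [folklore] -/
theorem closure_gens_eq_relations (hX : xMapRel ⊆ (KZ.relations : Set KZ.FormalRep)) :
    AddSubgroup.closure gens = KZ.relations := by
  refine le_antisymm ?_ relations_le_closure_gens
  rw [AddSubgroup.closure_le]
  rintro d (hd | hd)
  · exact AddSubgroup.subset_closure hd
  · exact hX hd

/-- Modulo transfer the crux is the kernel conjecture … [cite: KontsevichZagier2001, §1.2 Conjecture 1] -/
theorem iff_kzKernelConjecture_of_transfer (hT : XMapPeriodTransfer) : XMapKernel ↔ KZKernelConjecture := by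
  refine ⟨fun h c hc => ?_, fun hK => by_contra fun h => not_kzKernelConjecture_of_not h hK⟩
  rw [← closure_gens_eq_relations (xMapRel_subset_relations_iff_transfer.2 hT)]
  exact h c hc

/-- … i.e. the summit (the route's "honesty clause", now a theorem).
[cite: KontsevichZagier2001, §1.2 Conjecture 1] -/
theorem iff_summit_of_transfer (hT : XMapPeriodTransfer) : XMapKernel ↔ _root_.KontsevichZagierPeriods :=
  (iff_kzKernelConjecture_of_transfer hT).trans summit_iff_kzKernelConjecture.symm

/-- The summit implies the transfer crux as well (two-representation form with algebraic endpoints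
`KZPeriodConjecture'` ⇔ kernel form, in tree); contrapositive form.
[cite: KontsevichZagier2001, §1.2 Conjecture 1] -/
theorem not_summit_of_not_transfer (h : ¬ XMapPeriodTransfer) : ¬ _root_.KontsevichZagierPeriods :=
  fun hs => by
  have h' : KZPeriodConjecture' :=
    KZKernelConjecture.kzPeriodConjecture' (summit_iff_kzKernelConjecture.1 hs)
  exact h fun A B A' B' _ _ f g c _ _ a b _ _ r r' _ _ _ _ hv => h' r r' hv

/-- **The route thesis is an exact reformulation of the summit**:
`XMapPeriodTransfer ∧ XMapKernel ↔ KontsevichZagierPeriods` (`→` is the planner's deciding theorem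
`closes`; `←` is `not_summit_of_not` + `not_summit_of_not_transfer`).
[cite: KontsevichZagier2001, §1.2 Conjecture 1] -/
theorem thesis_iff_summit : (XMapPeriodTransfer ∧ XMapKernel) ↔ _root_.KontsevichZagierPeriods :=
  ⟨fun h => by
      -- buildfix 2026-08-19 (ops-buildfix lane): the route's `closes` was re-cut at rev 15 (2026-08-17) to take
      -- the three sector cells and the remainder `XMapKernelOfCells`; `closes h.1 h.2` no longer elaborates, so
      -- the body of the former two-hypothesis `closes` is inlined here verbatim (the four move sets and, by
      -- `h.1`, the x-map period relators lie in `KZ.relations`). Statement unchanged.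
      obtain ⟨hT, hK⟩ := h
      intro n m r r' _ _ hv
      have h0 : Literature.NumberTheory.Transcendental.KZ.eval
          (Literature.NumberTheory.Transcendental.KZ.of r - Literature.NumberTheory.Transcendental.KZ.of r') = 0 := by
        simp [Literature.NumberTheory.Transcendental.KZ.eval_of, hv]
      refine (AddSubgroup.closure_le _).mpr ?_ (hK _ h0)
      rintro d ((((hd | hd) | hd) | hd) | hd)
      · exact Literature.NumberTheory.Transcendental.KZ.domainAddRel_subset_relations hd
      · exact Literature.NumberTheory.Transcendental.KZ.integrandAddRel_subset_relations hd
      · exact Literature.NumberTheory.Transcendental.KZ.changeOfVariablesRel_subset_relations hd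
      · exact Literature.NumberTheory.Transcendental.KZ.newtonLeibnizRel_subset_relations hd
      · obtain ⟨A, B, A', B', f, g, c, a, b, ρ, ρ', hΔ, hΔ', hW, hI, ha, hb, h1, h2, h3, h4, h5, rfl⟩ := hd
        exact hT A B A' B' hΔ hΔ' f g c hW hI a b ha hb ρ ρ' h1 h2 h3 h4 h5,
    fun h =>
    ⟨by_contra fun hT => not_summit_of_not_transfer hT h, by_contra fun hK => not_summit_of_not hK h⟩⟩

/-! ### §2 The shape of any refutation -/

/-- `¬ crux` unfolded: an element of `ker eval` outside `closure gens`. [folklore] -/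
theorem not_iff : ¬ XMapKernel ↔ ∃ c : KZ.FormalRep, KZ.eval c = 0 ∧ c ∉ AddSubgroup.closure gens := by
  rw [crux_iff]
  push Not
  rfl

/-- **Separating-invariant template.** An additive invariant killing every generator (the four move
sets AND the x-map relators) but not some kernel element refutes the crux — and hence the summit.
[folklore] -/
theorem not_of_separating_invariant {G : Type*} [AddCommGroup G] (ψ : KZ.FormalRep →+ G)
    (hψ : gens ⊆ (ψ.ker : Set KZ.FormalRep)) {c : KZ.FormalRep} (hc : KZ.eval c = 0) (hψc : ψ c ≠ 0) :
    ¬ XMapKernel := fun h =>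
  hψc ((AddSubgroup.closure_le _).2 hψ (h c hc))

/-- The template is complete: from any counterexample, the quotient map by `closure gens` is a
separating invariant. [folklore] -/
theorem exists_separating_invariant_of_not (h : ¬ XMapKernel) :
    ∃ (ψ : KZ.FormalRep →+ KZ.FormalRep ⧸ AddSubgroup.closure gens) (c : KZ.FormalRep),
      gens ⊆ (ψ.ker : Set KZ.FormalRep) ∧ KZ.eval c = 0 ∧ ψ c ≠ 0 := by
  obtain ⟨c, hc, hcn⟩ := not_iff.1 h
  refine ⟨QuotientAddGroup.mk' _, c, fun d hd => ?_, hc, ?_⟩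
  · rw [SetLike.mem_coe, QuotientAddGroup.ker_mk']
    exact AddSubgroup.subset_closure hd
  · rwa [Ne, QuotientAddGroup.mk'_apply, QuotientAddGroup.eq_zero_iff]

/-! ### §3 Load-bearing analysis -/

/-- **`eval c = 0` is load-bearing** (the crux with its only hypothesis dropped, `closure gens = ⊤`,
is false): the honest generator `[pt, 1]` (`KZ.IntegralRep.unit`, value `1`) is not in
`closure gens ≤ ker eval`. [folklore] -/
theorem false_without_eval : ¬ (∀ c : KZ.FormalRep, c ∈ AddSubgroup.closure gens) := fun h => by
  have h1 := closure_gens_le_ker_eval (h (KZ.of KZ.IntegralRep.unit))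
  rw [AddMonoidHom.mem_ker, KZ.eval_of, KZ.IntegralRep.value_unit] at h1
  exact one_ne_zero h1

/-- Equivalently: the enlarged move group is a proper subgroup of `FormalRep`. [folklore] -/
theorem closure_gens_ne_top : AddSubgroup.closure gens ≠ ⊤ := fun h =>
  false_without_eval fun c => h ▸ AddSubgroup.mem_top c

/-- Generators without rule (3): moves (1a), (1b), (2) and the x-map relators. [folklore] -/
def gensWithoutNL : Set KZ.FormalRep :=
  KZ.domainAddRel ∪ KZ.integrandAddRel ∪ KZ.changeOfVariablesRel ∪ xMapRel

/-- Projection of a formal combination onto its dimension-`0` generators. [folklore] -/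
def dimZeroPart : KZ.FormalRep →+ KZ.FormalRep :=
  FreeAbelianGroup.lift fun p => if p.1 = 0 then FreeAbelianGroup.of p else 0

/-- `dimZeroPart [r] = [r]` in dimension `0`, `= 0` otherwise. [folklore] -/
@[simp] theorem dimZeroPart_of {n : ℕ} (r : KZ.IntegralRep n) :
    dimZeroPart (KZ.of r) = if n = 0 then KZ.of r else 0 := by
  simp [dimZeroPart, KZ.of]

/-- **The dimension-`0` evaluation**: evaluate only the `0`-dimensional generators (the real algebraic
constants `[pt, α]`). [folklore] -/
def dimZeroEval : KZ.FormalRep →+ ℝ := KZ.eval.comp dimZeroPart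

/-- `dimZeroEval [r] = value r` in dimension `0`, `= 0` otherwise. [folklore] -/
@[simp] theorem dimZeroEval_of {n : ℕ} (r : KZ.IntegralRep n) :
    dimZeroEval (KZ.of r) = if n = 0 then r.value else 0 := by
  simp only [dimZeroEval, AddMonoidHom.coe_comp, Function.comp_apply, dimZeroPart_of]
  split_ifs <;> simp

/-- Rule (1a) preserves `dimZeroEval` (it preserves the dimension and is sound).
[cite: KontsevichZagier2001, §1.2 rule (1)] -/
theorem dimZeroEval_eq_zero_of_mem_domainAddRel {c : KZ.FormalRep} (hc : c ∈ KZ.domainAddRel) :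
    dimZeroEval c = 0 := by
  have h0 : KZ.eval c = 0 := KZ.eval_eq_zero_of_mem_domainAddRel_holds hc
  obtain ⟨n, r, r₁, r₂, -, -, -, -, rfl⟩ := hc
  by_cases hn : n = 0
  · subst hn
    simpa [map_sub] using h0
  · simp [map_sub, hn]

/-- Rule (1b) preserves `dimZeroEval`. [cite: KontsevichZagier2001, §1.2 rule (1)] -/
theorem dimZeroEval_eq_zero_of_mem_integrandAddRel {c : KZ.FormalRep} (hc : c ∈ KZ.integrandAddRel) :
    dimZeroEval c = 0 := by
  have h0 : KZ.eval c = 0 := KZ.eval_eq_zero_of_mem_integrandAddRel_holds hc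
  obtain ⟨n, r, r₁, r₂, -, -, -, rfl⟩ := hc
  by_cases hn : n = 0
  · subst hn
    simpa [map_sub] using h0
  · simp [map_sub, hn]

/-- Rule (2) preserves `dimZeroEval`. [cite: KontsevichZagier2001, §1.2 rule (2)] -/
theorem dimZeroEval_eq_zero_of_mem_changeOfVariablesRel {c : KZ.FormalRep}
    (hc : c ∈ KZ.changeOfVariablesRel) : dimZeroEval c = 0 := by
  have h0 : KZ.eval c = 0 := KZ.eval_eq_zero_of_mem_changeOfVariablesRel_holds hc
  obtain ⟨n, r, r', Φ, Φ', -, -, -, -, -, rfl⟩ := hc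
  by_cases hn : n = 0
  · subst hn
    simpa [map_sub] using h0
  · simp [map_sub, hn]

/-- The x-map relators live in dimension `1`: invisible to `dimZeroEval`. [folklore] -/
theorem dimZeroEval_eq_zero_of_mem_xMapRel {c : KZ.FormalRep} (hc : c ∈ xMapRel) : dimZeroEval c = 0 := by
  obtain ⟨A, B, A', B', f, g, c, a, b, r, r', -, -, -, -, -, -, -, -, -, -, -, rfl⟩ := hc
  simp [map_sub]

/-- `closure gensWithoutNL ≤ ker dimZeroEval`. [folklore] -/
theorem closure_gensWithoutNL_le_ker : AddSubgroup.closure gensWithoutNL ≤ dimZeroEval.ker := by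
  rw [AddSubgroup.closure_le]
  rintro d (((hd | hd) | hd) | hd)
  · exact dimZeroEval_eq_zero_of_mem_domainAddRel hd
  · exact dimZeroEval_eq_zero_of_mem_integrandAddRel hd
  · exact dimZeroEval_eq_zero_of_mem_changeOfVariablesRel hd
  · exact dimZeroEval_eq_zero_of_mem_xMapRel hd

/-- The honest kernel element `[pt,1]·[0,1] − [pt,1]` (the unit slab — domain `[0,1] ⊆ ℝ¹`,
integrand `1` — minus the point of mass `1`). [cite: KontsevichZagier2001, §1.2 rule (3)] -/
def slabWitness : KZ.FormalRep := KZ.of (KZ.IntegralRep.unit.slab 0) - KZ.of KZ.IntegralRep.unit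

/-- `slabWitness` is ONE Newton–Leibniz move (`KZ.IntegralRep.of_slab_sub_of_mem_newtonLeibnizRel`).
[cite: KontsevichZagier2001, §1.2 rule (3)] -/
theorem slabWitness_mem_newtonLeibnizRel : slabWitness ∈ KZ.newtonLeibnizRel :=
  KZ.IntegralRep.of_slab_sub_of_mem_newtonLeibnizRel _ 0

/-- Hence `eval slabWitness = 0`. [folklore] -/
theorem eval_slabWitness : KZ.eval slabWitness = 0 :=
  KZ.eval_eq_zero_of_mem_newtonLeibnizRel_holds slabWitness_mem_newtonLeibnizRel

/-- Hence `slabWitness ∈ relations`. [folklore] -/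
theorem slabWitness_mem_relations : slabWitness ∈ KZ.relations :=
  KZ.newtonLeibnizRel_subset_relations slabWitness_mem_newtonLeibnizRel

/-- `dimZeroEval slabWitness = −1`. [folklore] -/
theorem dimZeroEval_slabWitness : dimZeroEval slabWitness = -1 := by
  simp [slabWitness, map_sub]

/-- `slabWitness ∉ closure gensWithoutNL`. [folklore] -/
theorem slabWitness_not_mem_closure_gensWithoutNL : slabWitness ∉ AddSubgroup.closure gensWithoutNL := by
  intro h
  have := closure_gensWithoutNL_le_ker h
  rw [AddMonoidHom.mem_ker, dimZeroEval_slabWitness] at this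
  norm_num at this

/-- **Any proof of the crux must use rule (3) (Newton–Leibniz)**: the crux with rule (3) dropped from
the generating set is false — the unit slab is an element of `ker eval` outside that closure.
[folklore] -/
theorem false_without_newtonLeibniz :
    ¬ (∀ c : KZ.FormalRep, KZ.eval c = 0 → c ∈ AddSubgroup.closure gensWithoutNL) := fun h =>
  slabWitness_not_mem_closure_gensWithoutNL (h _ eval_slabWitness)

/-- Generators without the additivity rules (1a), (1b): moves (2), (3) and the x-map relators.
[folklore] -/
def gensWithoutAdd : Set KZ.FormalRep := KZ.changeOfVariablesRel ∪ KZ.newtonLeibnizRel ∪ xMapRel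

/-- An x-map relator `[r] − [r′]` has coefficient sum `0`. [folklore] -/
theorem coeffSum_eq_zero_of_mem_xMapRel {c : KZ.FormalRep} (hc : c ∈ xMapRel) : KZ.coeffSum c = 0 := by
  obtain ⟨A, B, A', B', f, g, c, a, b, r, r', -, -, -, -, -, -, -, -, -, -, -, rfl⟩ := hc
  simp

/-- `closure gensWithoutAdd ≤ ker coeffSum` (tree: `KZ.coeffSum_eq_zero_of_mem_changeOfVariablesRel`,
`…_newtonLeibnizRel`, plus the relators). [folklore] -/
theorem closure_gensWithoutAdd_le_ker : AddSubgroup.closure gensWithoutAdd ≤ KZ.coeffSum.ker := by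
  rw [AddSubgroup.closure_le]
  rintro d ((hd | hd) | hd)
  · exact KZ.coeffSum_eq_zero_of_mem_changeOfVariablesRel hd
  · exact KZ.coeffSum_eq_zero_of_mem_newtonLeibnizRel hd
  · exact coeffSum_eq_zero_of_mem_xMapRel hd

/-- **Any proof of the crux must use an additivity move**: the crux with rules (1a), (1b) dropped from
the generating set is false — the empty representation `[∅]` (dimension `0`) has value `0` and
coefficient sum `1`. [folklore] -/
theorem false_without_additivity :
    ¬ (∀ c : KZ.FormalRep, KZ.eval c = 0 → c ∈ AddSubgroup.closure gensWithoutAdd) := fun h => by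
  have h1 := closure_gensWithoutAdd_le_ker (h (KZ.of (KZ.IntegralRep.empty 0)) (by simp))
  rw [AddMonoidHom.mem_ker, KZ.coeffSum_of] at h1
  exact one_ne_zero h1

/-- Dropping the x-map relators instead gives the kernel conjecture VERBATIM (open; equivalent to the
summit by `summit_iff_kzKernelConjecture`). [cite: KontsevichZagier2001, §1.2 Conjecture 1] -/
theorem withoutXMapRel_iff :
    (∀ c : KZ.FormalRep, KZ.eval c = 0 → c ∈ AddSubgroup.closure moves) ↔ KZKernelConjecture := Iff.rfl

/-! ### §4 Refuted strengthenings -/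

/-- No generating SUBSET avoiding rule (3) generates `ker eval`. [folklore] -/
theorem not_ker_le_closure_of_subset_withoutNL {T : Set KZ.FormalRep} (hT : T ⊆ gensWithoutNL) :
    ¬ (∀ c : KZ.FormalRep, KZ.eval c = 0 → c ∈ AddSubgroup.closure T) := fun h =>
  false_without_newtonLeibniz fun c hc => AddSubgroup.closure_mono hT (h c hc)

/-- No generating SUBSET avoiding both additivity rules generates `ker eval`. [folklore] -/
theorem not_ker_le_closure_of_subset_withoutAdd {T : Set KZ.FormalRep} (hT : T ⊆ gensWithoutAdd) :
    ¬ (∀ c : KZ.FormalRep, KZ.eval c = 0 → c ∈ AddSubgroup.closure T) := fun h =>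
  false_without_additivity fun c hc => AddSubgroup.closure_mono hT (h c hc)

/-- In particular the x-map relators alone do not generate `ker eval`. [folklore] -/
theorem not_ker_le_closure_xMapRel :
    ¬ (∀ c : KZ.FormalRep, KZ.eval c = 0 → c ∈ AddSubgroup.closure xMapRel) :=
  not_ker_le_closure_of_subset_withoutNL subset_union_right

end Summit.KontsevichZagierPeriods.XMapKernel.Negative
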